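import Summits.NavierStokesRegularity.NavierStokesRegularity.Theses.AxisymmetricExtremality
import Summits.NavierStokesRegularity.NavierStokesRegularity.Theorems.AxisymmetricExtremalityAxisymmetricKatoGlobalStubSeregin2020TypeIINoSwirlFirstSingular
import Summits.NavierStokesRegularity.NavierStokesRegularity.Theorems.AxisymmetricExtremalityAxisymmetricKatoGlobalStubSereginLogSwirlOriginTopTimePartialRegularity
import Literature.Analysis.FluidPDE.Seregin2020SingularSetAxis
import Literature.Analysis.FluidPDE.RusinSverakBackwardRegularityHolds
import Literature.Analysis.FluidPDE.SereginSverakPressureDecayBalls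
import HarnessLib

/-!
# Seregin 2022, §2 Step 1, honest form: the first singular time — a backward-singular point of
# the axis with a clean past and the cut-off configuration of Step 1 around it —
# crux stmt-NavierStokesRegularity-15453 (`AxisymmetricExtremality.AxisymmetricKatoGlobal`), line registered, support for stub `stub_sereginLogSwirlOrigin`

Support file (`--supports stmt-NavierStokesRegularity-15453`; theorems only, everything proved)
toward the registered stub `stub_sereginLogSwirlOrigin` = the named fact
`Literature.Analysis.FluidPDE.seregin2022_logSwirl_regularAtOrigin` (G. Seregin, J. Math. Fluid
Mech. 24 (2022), Paper 27 = arXiv:2201.00153, §2). Step 1 of the printed proof (arXiv p. 5)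
chooses a cut-off `η = φ(r)ψ(x₃)ξ(t)` "that takes into account the well known partial regularity
of axisymmetric flows": singular points lie on the axis and form a `𝒫¹`-null set, so "there
exist at least two regular points `z₁ = (0, h₁, 0)` and `z₂ = (0, -h₂, 0)` … cylinders
`Q(zᵢ, δ)` [where `v` is smooth] … one can find `t₀` such that there is no singular point in
`𝒞̄(r₀) × [t₀, t₀ + δ₀²]`", whence `v`, `∇v`, `∇²v` are bounded on `supp ∇η`. Step 3 then
multiplies the equations of `Φ = ω_r/r`, `Γ = ω_θ/r` by `Φη⁶`, `Γη⁶` and integrates over `𝒞`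
up to the top time `t = 0` — which tacitly uses smoothness on `supp η`, not only on `supp ∇η`.
The honest form of the argument is the FIRST SINGULAR TIME: if the origin were singular, the
backward-singular set near it — closed, on the axis, `𝒫¹`-null — has a point `ẑ = (t̂, x̂)` of
least time in a compact box, below which (and around which, at regular heights of the top slice
`t = t̂`) the solution is regular; the energy estimates of Step 3 run on that clean slab with
uniform constants, Step 4 makes `C(R; ẑ) → 0`, and `ẑ` would be regular. This file supplies the
geometric half of that argument for the hypothesis class (H) of the fact (Def. 1.1 in
`Q = 𝒞 × ]-1, 0[` + axisymmetric slices):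

* `backwardSingular_structure` (registered sub-goal) — for `0 < T, X < 1` the set
  `S = {(t, x) | -T ≤ t ≤ 0, ‖x‖ ≤ X, v ∉ L_∞(Q((t,x), r)) ∀ r > 0}` is closed, lies on the axis
  and is `𝒫¹`-null (`Seregin2020.offAxis_regular`, `isParabolicNull_backwardSingular_top`,
  centred regularity of backward-bounded interior points
  `isRegularPoint_of_eLpNorm_parabolicCylinder_lt_top_holds`, nesting of backward cylinders at
  the top time);
* `exists_firstSingular_configuration` (registered sub-goal) — if the origin is backward
  singular, there are an axis point `ẑ = (t̂, x̂)`, `-1/16 < t̂ ≤ 0`, `|x̂₃| ≤ 1/4`, a scale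
  `0 < R ≤ 1/4`, heights `h₋ < x̂₃ < h₊` and `δ > 0` with `[h± - δ, h± + δ] ⊆ [x̂₃ - R, x̂₃ + R]`,
  `h₋ + δ < x̂₃ < h₊ - δ`, such that: `ẑ` is backward singular; every point of the closed
  coordinate cylinder `{r ≤ R, |x₃ - x̂₃| ≤ R}` at the times `t̂ - R² ≤ t < t̂` is a (centred)
  regular point of `v` (clean past); and at the top time `t̂` every point of that cylinder off the
  axis, or of height within `δ` of `h₊` or `h₋`, is backward regular (the cylinders `Q(zᵢ, δ)` of
  the printed Step 1). First singular point: `exists_clean_first_singular_point_of_isParabolicNull`;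
  regular heights: `exists_not_mem_line_of_isParabolicNull`.

The sibling `…StubSereginLogSwirlOriginFinalReduction` turns this into the reduction of the fact
to its classical core (Steps 2–4 on the clean configuration).

## References

* G. Seregin, J. Math. Fluid Mech. 24 (2022), Paper No. 27 = arXiv:2201.00153, §2 Step 1 (arXiv
  p. 5) and Step 3 (pp. 6–7). [`Seregin2022LocalAxisym`]
* L. Caffarelli, R. Kohn, L. Nirenberg, Comm. Pure Appl. Math. 35 (1982), §6 (Theorem B).
  [`CaffarelliKohnNirenberg1982`]
-/

-- the problem directory repeats the summit name (D-0017); core's `dupNamespace` linter fires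
set_option linter.dupNamespace false

noncomputable section

open MeasureTheory Set Function Filter Topology TopologicalSpace Metric
open scoped NNReal ENNReal

namespace Summit.NavierStokesRegularity.NavierStokesRegularity.Theorems.AxisymmetricKatoGlobal.EulerScaling

open Literature.Analysis.FluidPDE Literature.Analysis.FluidPDE.Seregin2020
  Literature.Analysis.FluidPDE.SereginSverak2009

/-! ### Backward boundedness near a point -/

/-- **Backward boundedness propagates to nearby points of no later time** (nesting
`Q(y, r/2) ⊆ Q(z, r)` for `t_z - r²/2 < t_y ≤ t_z`, `dist(x_y, x_z) < r/2`). [folklore] -/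
theorem backwardRegular_of_near
    {v : ℝ → EuclideanSpace ℝ (Fin 3) → EuclideanSpace ℝ (Fin 3)}
    {z y : ℝ × EuclideanSpace ℝ (Fin 3)} {r : ℝ} (hr : 0 < r)
    (hfin : eLpNorm (uncurry v) ∞ (volume.restrict (parabolicCylinder r z)) < ∞)
    (ht : z.1 - r ^ 2 / 2 < y.1) (hty : y.1 ≤ z.1) (hx : dist y.2 z.2 < r / 2) :
    ∃ ρ > 0, eLpNorm (uncurry v) ∞ (volume.restrict (parabolicCylinder ρ y)) < ∞ := by
  -- adapted from `ancientLimit_backwardSingular_structure` (top-point nesting)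
  refine ⟨r / 2, by positivity,
    (eLpNorm_mono_measure _ (Measure.restrict_mono ?_ le_rfl)).trans_lt hfin⟩
  intro w hw
  rw [mem_parabolicCylinder] at hw ⊢
  refine ⟨⟨by nlinarith [hw.1.1], by linarith [hw.1.2]⟩, ?_⟩
  calc dist w.2 z.2 ≤ dist w.2 y.2 + dist y.2 z.2 := dist_triangle _ _ _
    _ < r / 2 + r / 2 := add_lt_add hw.2 hx
    _ = r := by ring

/-- **Near a (centred) regular point every point is backward regular**: if `v ∈ L_∞(Q*(z, ρ))`
then `v ∈ L_∞(Q(y, ρ/2))` for all `y` with `|t_y - t_z| < ρ²/4`, `dist(x_y, x_z) < ρ/2`.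
[folklore] -/
theorem eventually_backwardRegular_of_isRegularPoint
    {v : ℝ → EuclideanSpace ℝ (Fin 3) → EuclideanSpace ℝ (Fin 3)}
    {z : ℝ × EuclideanSpace ℝ (Fin 3)} (hreg : IsRegularPoint v z) :
    ∀ᶠ y in 𝓝 z, ∃ ρ > 0, eLpNorm (uncurry v) ∞ (volume.restrict (parabolicCylinder ρ y)) < ∞ := by
  -- adapted from `ancientLimit_backwardSingular_structure` (interior-point nesting)
  obtain ⟨ρ, hρ, hfin⟩ := hreg
  have hpos : 0 < min (ρ ^ 2 / 4) (ρ / 2) := lt_min (by positivity) (by positivity)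
  filter_upwards [Metric.ball_mem_nhds z hpos] with y hy
  rw [mem_ball, Prod.dist_eq, max_lt_iff, Real.dist_eq, lt_min_iff, lt_min_iff] at hy
  refine ⟨ρ / 2, by positivity,
    (eLpNorm_mono_measure _ (Measure.restrict_mono ?_ le_rfl)).trans_lt hfin⟩
  intro w hw
  rw [mem_parabolicCylinder] at hw
  rw [mem_parabolicCylinderCentered]
  have h1 := hy.1.1
  rw [abs_lt] at h1
  refine ⟨⟨by nlinarith [hw.1.1, h1.1], by nlinarith [hw.1.2, h1.2]⟩, ?_⟩
  calc dist w.2 z.2 ≤ dist w.2 y.2 + dist y.2 z.2 := dist_triangle _ _ _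
    _ < ρ / 2 + ρ / 2 := add_lt_add hw.2 hy.2.2
    _ = ρ := by ring

/-- A point with `-1 < t < 0` and `‖x‖ < 1` lies in the unit cylinder `Q = 𝒞 × ]-1, 0[`
(`B(0, 1) ⊆ 𝒞`). [folklore] -/
theorem mem_unitParCyl_of_norm_lt {z : ℝ × EuclideanSpace ℝ (Fin 3)} (h1 : -1 < z.1)
    (h2 : z.1 < 0) (h3 : ‖z.2‖ < 1) :
    z ∈ parCyl (0 : ℝ × EuclideanSpace ℝ (Fin 3)) 1 := by
  have hx : z.2 ∈ spaceCyl (0 : EuclideanSpace ℝ (Fin 3)) 1 :=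
    Literature.Analysis.FluidPDE.ball_subset_spaceCyl 0 1 (by rwa [mem_ball, dist_zero_right])
  exact ⟨⟨by simpa using h1, by simpa using h2⟩, hx⟩

/-- **Backward-bounded interior points of `Q` are regular points** (centred cylinders): for the
suitable weak solution `(v, q)` on `Q = 𝒞 × ]-1, 0[`, if `z ∈ Q` and `v ∈ L_∞(Q(z, r))` for some
`r > 0`, then `z` is a regular point of `v` (`isRegularPoint_of_eLpNorm_parabolicCylinder_lt_top_holds`
applied to a backward cylinder shrunk into `Q`). [folklore] -/
theorem isRegularPoint_of_backwardRegular
    {v : ℝ → EuclideanSpace ℝ (Fin 3) → EuclideanSpace ℝ (Fin 3)}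
    {q : ℝ → EuclideanSpace ℝ (Fin 3) → ℝ}
    (hsw : IsSuitableWeakSolutionOn (parCylOpens 0 1) 1 0 v q)
    {z : ℝ × EuclideanSpace ℝ (Fin 3)} (hz : z ∈ parCyl (0 : ℝ × EuclideanSpace ℝ (Fin 3)) 1)
    {r : ℝ} (hr : 0 < r)
    (hfin : eLpNorm (uncurry v) ∞ (volume.restrict (parabolicCylinder r z)) < ∞) :
    IsRegularPoint v z := by
  -- adapted from `ancientLimit_backwardSingular_structure` (interior points)
  obtain ⟨ε, hε, hεsub⟩ := Metric.isOpen_iff.1 (isOpen_parCyl 0 1) z hz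
  set r' : ℝ := min (min r ε) 1 with hr'
  have hr'pos : 0 < r' := lt_min (lt_min hr hε) one_pos
  have hr'r : r' ≤ r := (min_le_left _ _).trans (min_le_left _ _)
  have hr'ε : r' ≤ ε := (min_le_left _ _).trans (min_le_right _ _)
  have hr'1 : r' ≤ 1 := min_le_right _ _
  have hQsub : parabolicCylinder r' z ⊆
      ((parCylOpens (0 : ℝ × EuclideanSpace ℝ (Fin 3)) 1 :
        Opens (ℝ × EuclideanSpace ℝ (Fin 3))) : Set (ℝ × EuclideanSpace ℝ (Fin 3))) := by
    intro y hy
    refine hεsub ?_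
    rw [mem_parabolicCylinder] at hy
    rw [mem_ball, Prod.dist_eq, max_lt_iff, Real.dist_eq]
    have h1 : r' ^ 2 ≤ r' := by nlinarith
    refine ⟨?_, hy.2.trans_le hr'ε⟩
    rw [abs_lt]; constructor <;> linarith [hy.1.1, hy.1.2]
  have hfin' : eLpNorm (uncurry v) ∞ (volume.restrict (parabolicCylinder r' z)) < ∞ :=
    (eLpNorm_mono_measure _ (Measure.restrict_mono
      (parabolicCylinder_mono hr'pos.le hr'r z) le_rfl)).trans_lt hfin
  exact isRegularPoint_of_eLpNorm_parabolicCylinder_lt_top_holds _ v q hsw z hz r' hr'pos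
    hQsub hfin'

/-! ### Points near an axis point -/

/-- In the closed coordinate cylinder `{r ≤ R, |x₃ - c₃| ≤ R}` around an axis point `c`, every
point is within `2R` of `c` (indeed within `√2 R`). [folklore] -/
theorem norm_sub_le_of_cylRadius_le {x c : EuclideanSpace ℝ (Fin 3)} (hc : cylRadius c = 0)
    {R : ℝ} (h1 : cylRadius x ≤ R) (h2 : |x 2 - c 2| ≤ R) : ‖x - c‖ ≤ 2 * R := by
  obtain ⟨hc0, hc1⟩ := (cylRadius_eq_zero_iff c).1 hc
  have hR : 0 ≤ R := (cylRadius_nonneg x).trans h1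
  have hsq : ‖x - c‖ ^ 2 = x 0 ^ 2 + x 1 ^ 2 + (x 2 - c 2) ^ 2 := by
    rw [EuclideanSpace.norm_eq, Real.sq_sqrt (by positivity), Fin.sum_univ_three]
    simp [hc0, hc1, sq_abs]
  have hcyl : x 0 ^ 2 + x 1 ^ 2 ≤ R ^ 2 := by
    rw [← cylRadius_sq]
    exact pow_le_pow_left₀ (cylRadius_nonneg x) h1 2
  have h3 : (x 2 - c 2) ^ 2 ≤ R ^ 2 := by
    rw [← sq_abs]
    exact pow_le_pow_left₀ (abs_nonneg _) h2 2
  have hle : ‖x - c‖ ^ 2 ≤ (2 * R) ^ 2 := by rw [hsq]; nlinarith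
  exact (pow_le_pow_iff_left₀ (norm_nonneg _) (by positivity) two_ne_zero).1 hle

/-- Points `c + h e₃` above an axis point `c` are axis points of height `c₃ + h`. [folklore] -/
theorem cylRadius_add_smul_eZ_eq_zero {c : EuclideanSpace ℝ (Fin 3)} (hc : cylRadius c = 0)
    (h : ℝ) : cylRadius (c + h • eZ) = 0 ∧ (c + h • eZ) 2 = c 2 + h := by
  obtain ⟨hc0, hc1⟩ := (cylRadius_eq_zero_iff c).1 hc
  refine ⟨(cylRadius_eq_zero_iff _).2 ⟨?_, ?_⟩, ?_⟩ <;> simp [eZ, hc0, hc1]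

/-! ### The backward-singular set near the origin: closed, on the axis, `𝒫¹`-null -/

/-- **Seregin 2022, §2 Step 1: structure of the backward-singular set of `𝒞 × ]-1, 0]` in a
compact box** ("if singular points of an axisymmetric velocity field `v` exist, they must belong
to the axis of symmetry … the 1D parabolic Hausdorff measure of the set of singular points is
equal to zero", top time included). For the Def.-1.1 class in `Q = 𝒞 × ]-1, 0[` with
axisymmetric slices and `0 < T, X < 1`, the set `S` of points `z = (t, x)` with `-T ≤ t ≤ 0`,
`‖x‖ ≤ X` at which `v` is essentially unbounded on every backward cylinder `Q(z, r)` is closed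
(interior points: a backward-bounded point is a centred regular point,
`isRegularPoint_of_eLpNorm_parabolicCylinder_lt_top_holds`, and regular points have backward
regular neighbours; top points `t = 0`: nesting of backward cylinders), lies on the axis
(`Seregin2020.offAxis_regular`) and is `𝒫¹`-null (`isParabolicNull_backwardSingular_top`).
[cite: Seregin2022LocalAxisym, §2 Step 1 (arXiv:2201.00153 p. 5)] -/
theorem backwardSingular_structure : ∀ (v : ℝ → EuclideanSpace ℝ (Fin 3) → EuclideanSpace ℝ (Fin 3)) (q : ℝ → EuclideanSpace ℝ (Fin 3) → ℝ) (G : ℝ → EuclideanSpace ℝ (Fin 3) → EuclideanSpace ℝ (Fin 3) →L[ℝ] EuclideanSpace ℝ (Fin 3)), IsSuitableWeakSolutionOn (SereginSverak2009.parCylOpens 0 1) 1 0 v q → (∃ C : ℝ≥0, ∀ᵐ t ∂(volume.restrict (Ioo (-1 : ℝ) 0)), ∫⁻ x in SereginSverak2009.spaceCyl 0 1, ‖v t x‖ₑ ^ 2 ≤ C) → HasWeakSpatialGradientOn (SereginSverak2009.parCylOpens 0 1) v G → (∫⁻ z in SereginSverak2009.parCyl 0 1, ENNReal.ofReal (frobeniusNormSq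 (G z.1 z.2)) < ∞) → (∫⁻ z in SereginSverak2009.parCyl 0 1, ‖q z.1 z.2‖ₑ ^ (3 / 2 : ℝ) < ∞) → (∀ t ∈ Ioo (-1 : ℝ) 0, IsAxisymmetric (v t)) → ∀ (T X : ℝ), 0 < T → T < 1 → 0 < X → X < 1 → IsClosed {z : ℝ × EuclideanSpace ℝ (Fin 3) | z.1 ∈ Icc (-T) 0 ∧ ‖z.2‖ ≤ X ∧ ¬ ∃ r > 0, eLpNorm (uncurry v) ∞ (volume.restrict (parabolicCylinder r z)) < ∞} ∧ (∀ z ∈ {z : ℝ × EuclideanSpace ℝ (Fin 3) | z.1 ∈ Icc (-T) 0 ∧ ‖z.2‖ ≤ X ∧ ¬ ∃ r > 0, eLpNorm (uncurry v) ∞ (volume.restrict (parabolicCylinder r z)) < ∞}, cylRadius z.2 = 0) ∧ IsParabolicNull 1 {z : ℝ × EuclideanSpace ℝ (Fin 3) | z.1 ∈ Icc (-T) 0 ∧ ‖z.2‖ ≤ X ∧ ¬ ∃ r > 0, eLpNorm (uncurry v) ∞ (volume.restrict (parabolicCylinder r z)) < ∞} := by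
  intro v q G hsw hA hG hE hq hax T X hT hT1 hX hX1
  -- the box lies in `𝒞 × ]-1, 0]`
  have hwin : ∀ z : ℝ × EuclideanSpace ℝ (Fin 3), z.1 ∈ Icc (-T) 0 → ‖z.2‖ ≤ X →
      z.1 ∈ Ioc (-1 : ℝ) 0 ∧ z.2 ∈ spaceCyl (0 : EuclideanSpace ℝ (Fin 3)) 1 := fun z hz1 hz2 =>
    ⟨⟨by linarith [hz1.1], hz1.2⟩, Literature.Analysis.FluidPDE.ball_subset_spaceCyl 0 1
      (by rw [mem_ball, dist_zero_right]; linarith)⟩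
  refine ⟨?_, fun z hz => ?_, ?_⟩
  · -- ### closedness: the complement is open
    rw [← isOpen_compl_iff, Metric.isOpen_iff]
    intro z hz
    rw [mem_compl_iff, mem_setOf_eq] at hz
    by_cases h1 : z.1 ∈ Icc (-T) 0
    swap
    · -- outside the time window (an open condition)
      have ho : IsOpen {y : ℝ × EuclideanSpace ℝ (Fin 3) | y.1 ∈ Icc (-T) 0}ᶜ :=
        (isClosed_Icc.preimage continuous_fst).isOpen_compl
      obtain ⟨ε, hε, hsub⟩ := Metric.isOpen_iff.1 ho z h1
      exact ⟨ε, hε, fun y hy hyS => hsub hy hyS.1⟩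
    by_cases h2 : ‖z.2‖ ≤ X
    swap
    · -- outside the ball (an open condition)
      have ho : IsOpen {y : ℝ × EuclideanSpace ℝ (Fin 3) | ‖y.2‖ ≤ X}ᶜ :=
        (isClosed_le (continuous_norm.comp continuous_snd) continuous_const).isOpen_compl
      obtain ⟨ε, hε, hsub⟩ := Metric.isOpen_iff.1 ho z h2
      exact ⟨ε, hε, fun y hy hyS => hsub hy hyS.2.1⟩
    have hreg : ∃ r > 0, eLpNorm (uncurry v) ∞ (volume.restrict (parabolicCylinder r z)) < ∞ := by
      by_contra hcon
      exact hz ⟨h1, h2, hcon⟩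
    obtain ⟨r, hr, hfin⟩ := hreg
    rcases h1.2.lt_or_eq with hlt | heq
    · -- interior point: centred regularity, then backward regular neighbours
      have hzQ : z ∈ parCyl (0 : ℝ × EuclideanSpace ℝ (Fin 3)) 1 :=
        mem_unitParCyl_of_norm_lt (by linarith [h1.1]) hlt (by linarith)
      have hregc : IsRegularPoint v z := isRegularPoint_of_backwardRegular hsw hzQ hr hfin
      obtain ⟨ε, hε, hsub⟩ := Metric.eventually_nhds_iff_ball.1
        (eventually_backwardRegular_of_isRegularPoint hregc)
      exact ⟨ε, hε, fun y hy hyS => hyS.2.2 (hsub y hy)⟩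
    · -- top point: nesting of backward cylinders
      refine ⟨min (r ^ 2 / 2) (r / 2), lt_min (by positivity) (by positivity), fun y hy hyS => ?_⟩
      rw [mem_ball, Prod.dist_eq, max_lt_iff, Real.dist_eq, lt_min_iff, lt_min_iff] at hy
      have ht := hy.1.1
      rw [abs_lt] at ht
      have hy0 : y.1 ≤ z.1 := heq ▸ hyS.1.2
      exact hyS.2.2 (backwardRegular_of_near hr hfin (by linarith [ht.1]) hy0 hy.2.2)
  · -- ### on the axis: off-axis points are backward regular up to the top
    obtain ⟨hz1, hz2, hsing⟩ := hz
    by_contra hoff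
    have hoff' : 0 < cylRadius z.2 := (cylRadius_nonneg _).lt_of_ne (Ne.symm hoff)
    obtain ⟨ht, hx⟩ := hwin z hz1 hz2
    obtain ⟨r, hr, hfin⟩ := offAxis_regular hsw hA hG hE hq hax ht hx hoff'
    exact hsing ⟨r, hr, hfin⟩
  · -- ### `𝒫¹`-nullity: a subset of the backward-singular set of `𝒞 × ]-1, 0]`
    refine (isParabolicNull_backwardSingular_top v q G hsw hA hG hE hq).mono ?_
    rintro z ⟨hz1, hz2, hsing⟩
    exact ⟨(hwin z hz1 hz2).1, (hwin z hz1 hz2).2, hsing⟩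

/-! ### The first singular point and the Step-1 configuration around it -/

/-- **Seregin 2022, §2 Step 1 in first-singular-time form.** Let `(v, q)` be in the Def.-1.1
class in `Q = 𝒞 × ]-1, 0[` with a weak gradient `G ∈ L₂(Q)` and axisymmetric slices, and suppose
the origin is backward singular (`v ∉ L_∞(Q((0,0), r))` for every `r > 0`). Then there are an
axis point `ẑ = (t̂, x̂)` with `-1/16 < t̂ ≤ 0`, `|x̂₃| ≤ 1/4`, a scale `0 < R ≤ 1/4`, heights
`h₊`, `h₋` and `δ > 0` with `x̂₃ - R ≤ h₋ - δ`, `h₋ + δ < x̂₃ < h₊ - δ`, `h₊ + δ ≤ x̂₃ + R`, such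
that (i) `ẑ` is backward singular; (ii) CLEAN PAST: every `z = (t, x)` with `t̂ - R² ≤ t < t̂`,
`|x'| ≤ R`, `|x₃ - x̂₃| ≤ R` is a regular point of `v` (first singular time in a compact box,
`exists_clean_first_singular_point_of_isParabolicNull` for the closed, axial, `𝒫¹`-null set of
`backwardSingular_structure`, then centred regularity of backward-bounded interior points);
(iii) TOP SLICE: every `x` with `|x'| ≤ R`, `|x₃ - x̂₃| ≤ R` which is off the axis
(`Seregin2020.offAxis_regular`) or has height within `δ` of `h₊` or of `h₋` (regular heights exist
on every segment since a `𝒫¹`-null set contains no segment, `exists_not_mem_line_of_isParabolicNull`;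
these are the printed "two regular points `z₁ = (0, h₁, 0)`, `z₂ = (0, -h₂, 0)` … cylinders
`Q(zᵢ, δ)`") is backward regular at time `t̂`. This is the configuration on which the cut-off
`η = φ(r)ψ(x₃)ξ(t)` of Step 1 is built with `v` smooth on `supp ∇η` up to the top time and on
`supp η` strictly below it.
[cite: Seregin2022LocalAxisym, §2 Step 1 (arXiv:2201.00153 p. 5)] -/
theorem exists_firstSingular_configuration : ∀ (v : ℝ → EuclideanSpace ℝ (Fin 3) → EuclideanSpace ℝ (Fin 3)) (q : ℝ → EuclideanSpace ℝ (Fin 3) → ℝ) (G : ℝ → EuclideanSpace ℝ (Fin 3) → EuclideanSpace ℝ (Fin 3) →L[ℝ] EuclideanSpace ℝ (Fin 3)), IsSuitableWeakSolutionOn (SereginSverak2009.parCylOpens 0 1) 1 0 v q → (∃ C : ℝ≥0, ∀ᵐ t ∂(volume.restrict (Ioo (-1 : ℝ) 0)), ∫⁻ x in SereginSverak2009.spaceCyl 0 1, ‖v t x‖ₑ ^ 2 ≤ C) → HasWeakSpatialGradientOn (SereginSverak2009.parCylOpens 0 1) v G → (∫⁻ z in SereginSverak2009.parCyl 0 1,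 ENNReal.ofReal (frobeniusNormSq (G z.1 z.2)) < ∞) → (∫⁻ z in SereginSverak2009.parCyl 0 1, ‖q z.1 z.2‖ₑ ^ (3 / 2 : ℝ) < ∞) → (∀ t ∈ Ioo (-1 : ℝ) 0, IsAxisymmetric (v t)) → (¬ ∃ r > 0, eLpNorm (uncurry v) ∞ (volume.restrict (parabolicCylinder r (0 : ℝ × EuclideanSpace ℝ (Fin 3)))) < ∞) → ∃ (zc : ℝ × EuclideanSpace ℝ (Fin 3)) (R hp hm δ : ℝ), zc.1 ∈ Ioc (-1 / 16 : ℝ) 0 ∧ cylRadius zc.2 = 0 ∧ |zc.2 2| ≤ 1 / 4 ∧ 0 < R ∧ R ≤ 1 / 4 ∧ (¬ ∃ r > 0, eLpNorm (uncurry v) ∞ (volume.restrict (parabolicCylinder r zc)) < ∞) ∧ (∀ z : ℝ × EuclideanSpace ℝ (Fin 3), zc.1 - R ^ 2 ≤ z.1 → z.1 < zc.1 → cylRadius z.2 ≤ R → |z.2 2 - zc.2 2| ≤ R → IsRegularPoint v z) ∧ 0 < δ ∧ zc.2 2 - R ≤ hm - δ ∧ hm + δ < zc.2 2 ∧ zc.2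 2 < hp - δ ∧ hp + δ ≤ zc.2 2 + R ∧ (∀ x : EuclideanSpace ℝ (Fin 3), cylRadius x ≤ R → |x 2 - zc.2 2| ≤ R → (0 < cylRadius x ∨ |x 2 - hp| < δ ∨ |x 2 - hm| < δ) → ∃ r > 0, eLpNorm (uncurry v) ∞ (volume.restrict (parabolicCylinder r (zc.1, x))) < ∞) := by
  intro v q G hsw hA hG hE hq hax hsing
  obtain ⟨hclosed, haxis, hnull⟩ := backwardSingular_structure v q G hsw hA hG hE hq hax
    (1 / 16) (1 / 2) (by norm_num) (by norm_num) (by norm_num) (by norm_num)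
  -- ### the first singular point below the origin
  obtain ⟨zc, hzcS, R, hR, hRδ, hzc1, hzcd, hclean⟩ :=
    exists_clean_first_singular_point_of_isParabolicNull _ hclosed haxis hnull 0
      ⟨⟨by norm_num, le_rfl⟩, by simp, hsing⟩ (1 / 8) (by norm_num)
  obtain ⟨hzc_t, hzc_n, hzc_sing⟩ := hzcS
  have hzc0 : cylRadius zc.2 = 0 := haxis zc ⟨hzc_t, hzc_n, hzc_sing⟩
  have ht1 : -(1 / 64 : ℝ) < zc.1 := by have h := hzc1.1; norm_num at h; linarith
  have ht2 : zc.1 ≤ 0 := hzc_t.2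
  have hxn : ‖zc.2‖ < 1 / 8 := by simpa using hzcd
  have hx3 : |zc.2 2| ≤ ‖zc.2‖ := by simpa using PiLp.norm_apply_le zc.2 2
  -- ### the scale
  set R' : ℝ := R / 2 with hR'
  have hR'pos : 0 < R' := by positivity
  have hR'le : R' ≤ 1 / 16 := by rw [hR']; linarith
  -- ### two regular heights on the top slice
  -- `‖e₃‖ = 1` (in tree as `Literature.Barriers.NavierStokesRegularity.norm_eZ_eq_one`, not imported)
  have norm_eZ : ‖(eZ : EuclideanSpace ℝ (Fin 3))‖ = 1 := by
    rw [EuclideanSpace.norm_eq, Fin.sum_univ_three]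
    simp [eZ]
  obtain ⟨a, ha, hnotS⟩ := exists_not_mem_line_of_isParabolicNull _ hnull zc.1 zc.2 eZ norm_eZ
    (R' / 4) (3 * R' / 4) (by linarith)
  obtain ⟨b, hb, hnotS'⟩ := exists_not_mem_line_of_isParabolicNull _ hnull zc.1 zc.2 eZ norm_eZ
    (-(3 * R' / 4)) (-(R' / 4)) (by linarith)
  obtain ⟨hpa0, hpa2⟩ := cylRadius_add_smul_eZ_eq_zero hzc0 a
  obtain ⟨hpb0, hpb2⟩ := cylRadius_add_smul_eZ_eq_zero hzc0 b
  have hsegreg : ∀ c : ℝ, |c| < R' → (zc.1, zc.2 + c • eZ) ∉ {z : ℝ × EuclideanSpace ℝ (Fin 3) |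
      z.1 ∈ Icc (-(1 / 16 : ℝ)) 0 ∧ ‖z.2‖ ≤ 1 / 2 ∧
        ¬ ∃ r > 0, eLpNorm (uncurry v) ∞ (volume.restrict (parabolicCylinder r z)) < ∞} →
      ∃ r > 0, eLpNorm (uncurry v) ∞
        (volume.restrict (parabolicCylinder r ((zc.1, zc.2 + c • eZ) : ℝ × _))) < ∞ := by
    intro c hc hnot
    by_contra hcon
    refine hnot ⟨⟨by linarith, ht2⟩, ?_, hcon⟩
    calc ‖zc.2 + c • eZ‖ ≤ ‖zc.2‖ + ‖c • eZ‖ := norm_add_le _ _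
      _ = ‖zc.2‖ + |c| := by rw [norm_smul, norm_eZ, mul_one, Real.norm_eq_abs]
      _ ≤ 1 / 2 := by linarith
  obtain ⟨rp, hrp, hfinp⟩ := hsegreg a (by rw [abs_lt]; constructor <;> linarith [ha.1, ha.2]) hnotS
  obtain ⟨rm, hrm, hfinm⟩ := hsegreg b (by rw [abs_lt]; constructor <;> linarith [hb.1, hb.2]) hnotS'
  -- ### the width of the strips
  set δ : ℝ := min (min (rp / 4) (rm / 4)) (R' / 8) with hδ
  have hδpos : 0 < δ := lt_min (lt_min (by positivity) (by positivity)) (by positivity)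
  have hδp : δ ≤ rp / 4 := (min_le_left _ _).trans (min_le_left _ _)
  have hδm : δ ≤ rm / 4 := (min_le_left _ _).trans (min_le_right _ _)
  have hδR : δ ≤ R' / 8 := min_le_right _ _
  refine ⟨zc, R', zc.2 2 + a, zc.2 2 + b, δ, ⟨by linarith, ht2⟩, hzc0,
    by linarith [hx3], hR'pos, by linarith, hzc_sing, ?_, hδpos, by linarith [hb.1],
    by linarith [hb.2], by linarith [ha.1], by linarith [ha.2], ?_⟩
  · -- ### (ii) the clean past
    intro z hzt1 hzt2 hzR hz3
    have hnorm : ‖z.2 - zc.2‖ ≤ 2 * R' := norm_sub_le_of_cylRadius_le hzc0 hzR hz3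
    have hzn : ‖z.2‖ ≤ 1 / 4 := by linarith [norm_sub_norm_le z.2 zc.2]
    have hR'sq1 : R' ^ 2 ≤ (1 / 16 : ℝ) ^ 2 := pow_le_pow_left₀ hR'pos.le hR'le 2
    have hreg : ∃ r > 0, eLpNorm (uncurry v) ∞ (volume.restrict (parabolicCylinder r z)) < ∞ := by
      by_contra hcon
      have hR'sq : R' ^ 2 ≤ R ^ 2 := by rw [hR']; nlinarith
      have hzS : z ∈ {z : ℝ × EuclideanSpace ℝ (Fin 3) | z.1 ∈ Icc (-(1 / 16 : ℝ)) 0 ∧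
          ‖z.2‖ ≤ 1 / 2 ∧
          ¬ ∃ r > 0, eLpNorm (uncurry v) ∞ (volume.restrict (parabolicCylinder r z)) < ∞} :=
        ⟨⟨by linarith, by linarith⟩, by linarith, hcon⟩
      have h := hclean z hzS (by rw [dist_eq_norm]; linarith) (by linarith) hzt2.le
      exact absurd h.1 hzt2.ne
    obtain ⟨r, hr, hfin⟩ := hreg
    exact isRegularPoint_of_backwardRegular hsw
      (mem_unitParCyl_of_norm_lt (by linarith) (by linarith) (by linarith)) hr hfin
  · -- ### (iii) the top slice: off the axis, and the two strips
    intro x hxR hx3' hdisj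
    by_cases hx0 : 0 < cylRadius x
    · have ht : ((zc.1, x) : ℝ × EuclideanSpace ℝ (Fin 3)).1 ∈ Ioc (-1 : ℝ) 0 :=
        ⟨by simp only; linarith, ht2⟩
      have hx : ((zc.1, x) : ℝ × EuclideanSpace ℝ (Fin 3)).2 ∈
          spaceCyl (0 : EuclideanSpace ℝ (Fin 3)) 1 := by
        rw [mem_spaceCyl, sub_zero]
        refine ⟨by simp only; linarith, ?_⟩
        have h3 : |x 2| ≤ |x 2 - zc.2 2| + |zc.2 2| := by
          simpa using abs_add_le (x 2 - zc.2 2) (zc.2 2)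
        simpa using (show |x 2| < 1 by linarith)
      obtain ⟨r, hr, hfin⟩ := offAxis_regular hsw hA hG hE hq hax ht hx hx0
      exact ⟨r, hr, hfin⟩
    · have hx0' : cylRadius x = 0 := le_antisymm (not_lt.1 hx0) (cylRadius_nonneg x)
      rcases hdisj with h | h | h
      · exact absurd h hx0
      · refine backwardRegular_of_near hrp hfinp (y := (zc.1, x)) ?_ le_rfl ?_
        · show zc.1 - rp ^ 2 / 2 < zc.1
          linarith [pow_pos hrp 2]
        · show dist x (zc.2 + a • eZ) < rp / 2
          rw [dist_eq_abs_sub_of_cylRadius_eq_zero hx0' hpa0, hpa2]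
          linarith
      · refine backwardRegular_of_near hrm hfinm (y := (zc.1, x)) ?_ le_rfl ?_
        · show zc.1 - rm ^ 2 / 2 < zc.1
          linarith [pow_pos hrm 2]
        · show dist x (zc.2 + b • eZ) < rm / 2
          rw [dist_eq_abs_sub_of_cylRadius_eq_zero hx0' hpb0, hpb2]
          linarith

end Summit.NavierStokesRegularity.NavierStokesRegularity.Theorems.AxisymmetricKatoGlobal.EulerScaling

end
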